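import Summits.KontsevichZagierPeriods.KontsevichZagierPeriods.Theorems.LinRedNormalFormArrangementNormalFormSeparateThreeFatDiverge
import Summits.KontsevichZagierPeriods.KontsevichZagierPeriods.Theorems.LinRedNormalFormArrangementNormalFormSeparateThreeFatLower
import Summits.KontsevichZagierPeriods.KontsevichZagierPeriods.Theorems.LinRedNormalFormArrangementNormalFormSeparateThreeFatAlgebra
import Summits.KontsevichZagierPeriods.KontsevichZagierPeriods.Theorems.LinRedNormalFormArrangementNormalFormSeparateThreeUnblocked

/-!
# Cancelling a fat letter (stub `stub_separateThreeZero`, part `Fat`)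

(Line `janus-bands`, crux `ArrangementNormalForm`, stub `stub_separateThreeZero` — fibre-free
separation over a bounded rational polytope in `ℝ³`, `JJ 3 0 → closure (GG 2 1 0)`; part `Fat`
of the CANCELLATION lemma `JJ 3 0 ≡ thin JJ 3 0`.)

**Theorem** (`SepThree.fat_cancel`, registered as `separateThree_fat_cancel`). For an arrangement
representation in engine coordinates (polyhedral cell in `ℝ³`, integrand `P/∏ L_i^{e_i}`,
active letters non-vanishing on the cell) and an active `y`-letter `L_j = α (y − λ(x'))` whose
contact with the closed cell is FAT (not inside a line), the numerator factors through the
letter at every real point: `P = L_j · P₁` for an explicit rational polynomial `P₁`. Proof: by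
`SepThree.fat_patch` the plane `y = λ(x')` contains the graph over a ball of the base inside the
closed cell; either `P` vanishes on it — then the constant Taylor coefficient of `P` at `λ`
vanishes on a ball, hence is zero (`fat_eq_zero_of_ball`, `fat_q0_eq`) and `P = (y − λ) P₁'`
(`fat_factor`) — or `P ≠ 0` at some graph point, where `|P/∏L^e| ≥ c'/|y − λ|`
(`fat_lower`) contradicts absolute convergence (`fat_diverge`).
-/

noncomputable section

open Set MeasureTheory Filter Topology

namespace Summit.KontsevichZagierPeriods.ArrangementNormalForm.JanusBands

open Literature.NumberTheory.Transcendental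

namespace SepThree

open SeparatePos MvPolynomial

/-- The base index `y` of `Fin (2 + 1 + 0)`. -/
theorem fat_cA_last : (Fin.castAdd 0 (Fin.last 2) : Fin (2 + 1 + 0)) = Fin.last 2 := rfl

/-- The base indices `x'` of `Fin (2 + 1 + 0)`. -/
theorem fat_cA_cs (i : Fin 2) : (Fin.castAdd 0 (Fin.castSucc i) : Fin (2 + 1 + 0)) = Fin.castSucc i :=
  rfl

/-- The base point of `z ∈ ℝ^{2+1+0}` is `z`. -/
theorem fat_base_fun (z : Fin (2 + 1 + 0) → ℝ) : (fun i : Fin (2 + 1) => z (Fin.castAdd 0 i)) = z :=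
  rfl

/-- **Cancelling a fat letter**: see the module docstring. -/
theorem fat_cancel {m m' : ℕ} (s : KZ.IntegralRep (2 + 1 + 0))
    (M : Fin m' → (Fin (2 + 1) → ℚ) × ℚ) (L : Fin m → (Fin (2 + 1) → ℚ) × ℚ) (e : Fin m → ℕ)
    (p : MvPolynomial (Fin (2 + 1)) ℚ) (a : Fin 0 → Option ((Fin (2 + 1) → ℚ) × ℚ))
    (lo hi : Fin 0 → Fin 0 ⊕ ((Fin (2 + 1) → ℚ) × ℚ))
    (hbd : Bornology.IsBounded s.domain) (hdom : s.domain = gDom 2 0 m' M lo hi)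
    (hint : EqOn s.integrand (fun z => MvPolynomial.aeval (fun i => z (Fin.castAdd 0 i)) p /
      (∏ j, affF 2 0 (L j) z ^ e j) * SeparatePos.fib 2 0 a z) s.domain)
    (hnz : ∀ i, e i ≠ 0 → ∀ z ∈ s.domain, affF 2 0 (L i) z ≠ 0)
    (j : Fin m) (hej : e j ≠ 0) (hα : (L j).1 (Fin.last 2) ≠ 0)
    (hfat : ¬ ∃ P u : Fin (2 + 1 + 0) → ℝ, ∀ z ∈ closure s.domain, affF 2 0 (L j) z = 0 →
      ∃ t : ℝ, z = P + t • u) :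
    ∃ p₁ : MvPolynomial (Fin (2 + 1)) ℚ, ∀ z : Fin (2 + 1 + 0) → ℝ,
      MvPolynomial.aeval (fun i => z (Fin.castAdd 0 i)) p =
        affF 2 0 (L j) z * MvPolynomial.aeval (fun i => z (Fin.castAdd 0 i)) p₁ := by
  classical
  -- the pole data of the letter
  set lam : (Fin 2 → ℚ) × ℚ := root 2 (L j) with hlamdef
  set κ : Fin 2 → ℝ := fun i => (lam.1 i : ℝ) with hκ
  set cc : ℝ := (lam.2 : ℝ) with hcc
  set αq : ℚ := (L j).1 (Fin.last 2) with hαq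
  have hα' : (αq : ℝ) ≠ 0 := by exact_mod_cast hα
  set chat : MvPolynomial (Fin 2) ℚ := ∑ i, MvPolynomial.C (lam.1 i) * MvPolynomial.X i +
    MvPolynomial.C lam.2 with hchat
  have haeval_c : ∀ x : Fin 2 → ℝ, MvPolynomial.aeval x chat = κ 0 * x 0 + κ 1 * x 1 + cc := by
    intro x
    simp [hchat, Fin.sum_univ_two, hκ, hcc]
  have haffB : ∀ z : Fin (2 + 1 + 0) → ℝ, affB 2 0 lam z =
      κ 0 * z (Fin.castSucc 0) + κ 1 * z (Fin.castSucc 1) + cc := fun z => by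
    simp [affB, Fin.sum_univ_two, hκ, hcc, fat_cA_cs]
  have haffF : ∀ z : Fin (2 + 1 + 0) → ℝ, affF 2 0 (L j) z =
      (αq : ℝ) * (z (Fin.last 2) - (κ 0 * z (Fin.castSucc 0) + κ 1 * z (Fin.castSucc 1) + cc)) :=
    fun z => by rw [affF_of_ne_zero (L j) z hα, ← hlamdef, haffB, fat_cA_last]
  have hsnoc : ∀ z : Fin (2 + 1 + 0) → ℝ, z = Fin.snoc (fun i : Fin 2 => z (Fin.castSucc i))
      (z (Fin.last 2)) := fun z => (Fin.snoc_init_self (q := z)).symm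
  -- Taylor expansion at the letter
  obtain ⟨N, q, -, hT⟩ := exists_taylor chat p
  -- the numerator vanishing identically: nothing to do
  by_cases hp0 : ∀ (x : Fin 2 → ℝ) (y : ℝ), MvPolynomial.aeval (Fin.snoc x y : Fin (2 + 1) → ℝ) p = 0
  · refine ⟨0, fun z => ?_⟩
    rw [fat_base_fun, map_zero, mul_zero, hsnoc z]
    exact hp0 _ _
  push Not at hp0
  obtain ⟨x₉, y₉, h₉⟩ := hp0
  have hN : 0 < N := by
    by_contra hN
    push Not at hN
    have : N = 0 := by omega
    refine h₉ ?_
    rw [hT, this, Finset.sum_range_zero]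
  -- the constant Taylor coefficient vanishes
  have hq0 : q 0 = 0 := by
    have hcv : Convex ℝ s.domain := by rw [hdom]; exact convex_gDom m' M lo hi
    have hop : IsOpen s.domain := by rw [hdom]; exact isOpen_gDom m' M lo hi
    have hfat' : ¬ ∃ P u : Fin (2 + 1) → ℝ, ∀ z ∈ closure s.domain,
        z (Fin.last 2) = κ 0 * z (Fin.castSucc 0) + κ 1 * z (Fin.castSucc 1) + cc →
        ∃ t : ℝ, z = P + t • u := by
      rintro ⟨P, u, h⟩
      refine hfat ⟨P, u, fun z hz h0 => h z hz ?_⟩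
      rw [haffF, mul_eq_zero, sub_eq_zero] at h0
      exact h0.resolve_left hα'
    obtain ⟨x₀, ρ, hρ, hpatch⟩ := fat_patch hcv.closure κ cc hfat'
    by_cases hall : ∀ x : Fin 2 → ℝ, dist x x₀ < ρ →
        MvPolynomial.aeval (Fin.snoc x (κ 0 * x 0 + κ 1 * x 1 + cc) : Fin (2 + 1) → ℝ) p = 0
    · refine fat_eq_zero_of_ball (q 0) x₀ hρ fun x hx => ?_
      rw [fat_q0_eq chat p hT hN x, haeval_c]
      exact hall x hx
    · exfalso
      push Not at hall
      obtain ⟨x₂, hx₂, hp₂⟩ := hall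
      set z₂ : Fin (2 + 1 + 0) → ℝ := Fin.snoc x₂ (κ 0 * x₂ 0 + κ 1 * x₂ 1 + cc) with hz₂
      have hp₂' : MvPolynomial.aeval (fun i => z₂ (Fin.castAdd 0 i)) p ≠ 0 := by
        rw [fat_base_fun]; exact hp₂
      obtain ⟨c', hc', ρ₁, hρ₁, hlow⟩ := fat_lower L e p a hbd hnz j hej hα z₂ hp₂'
      refine fat_diverge hop hcv s.integrableOn κ cc x₂ (sub_pos.2 hx₂) (fun x hx => hpatch x ?_)
        (fun z hz h0 => ?_) hc' hρ₁ (fun z hz hdz => ?_)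
      · calc dist x x₀ ≤ dist x x₂ + dist x₂ x₀ := dist_triangle _ _ _
          _ < ρ := by linarith
      · refine hnz j hej z hz ?_
        rw [haffF, h0, mul_zero]
      · have h1 := hlow z hz hdz
        rw [fat_cA_last, ← hlamdef, haffB] at h1
        have h2 : |s.integrand z| = |MvPolynomial.aeval (fun i => z (Fin.castAdd 0 i)) p /
            (∏ i, affF 2 0 (L i) z ^ e i) * SeparatePos.fib 2 0 a z| := by rw [hint hz]
        rw [h2]
        exact h1
  -- the factorisation
  obtain ⟨p₁, hp₁⟩ := fat_factor chat p hT hq0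
  refine ⟨MvPolynomial.C αq⁻¹ * p₁, fun z => ?_⟩
  rw [fat_base_fun, map_mul, MvPolynomial.aeval_C, haffF, hsnoc z, hp₁, haeval_c]
  simp only [Fin.snoc_last, Fin.snoc_castSucc, eq_ratCast, Rat.cast_inv]
  field_simp

end SepThree

open SepThree SeparatePos in
/-- **Cancelling a fat letter** (registered sub-goal of `stub_separateThreeZero`, part `Fat`; see
`SepThree.fat_cancel` and the module docstring). -/
theorem separateThree_fat_cancel (m m' : ℕ) (s : KZ.IntegralRep (2 + 1 + 0)) (M : Fin m' → (Fin (2 + 1) → ℚ) × ℚ) (L : Fin m → (Fin (2 + 1) → ℚ) × ℚ) (e : Fin m → ℕ) (p : MvPolynomial (Fin (2 + 1)) ℚ) (a : Fin 0 → Option ((Fin (2 + 1) → ℚ) × ℚ)) (lo hi : Fin 0 → Fin 0 ⊕ ((Fin (2 + 1) → ℚ) × ℚ)) (hbd : Bornology.IsBounded s.domain) (hdom : s.domain = SeparatePos.gDom 2 0 m' M lo hi) (hint : EqOn s.integrand (fun z => MvPolynomial.aeval (fun i => z (Fin.castAdd 0 i)) p / (∏ j, SeparatePos.affF 2 0 (L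 j) z ^ e j) * SeparatePos.fib 2 0 a z) s.domain) (hnz : ∀ i, e i ≠ 0 → ∀ z ∈ s.domain, SeparatePos.affF 2 0 (L i) z ≠ 0) (j : Fin m) (hej : e j ≠ 0) (hα : (L j).1 (Fin.last 2) ≠ 0) (hfat : ¬ ∃ P u : Fin (2 + 1 + 0) → ℝ, ∀ z ∈ closure s.domain, SeparatePos.affF 2 0 (L j) z = 0 → ∃ t : ℝ, z = P + t • u) : ∃ p₁ : MvPolynomial (Fin (2 + 1)) ℚ, ∀ z : Fin (2 + 1 + 0) → ℝ, MvPolynomial.aeval (fun i => z (Fin.castAdd 0 i)) p = SeparatePos.affF 2 0 (L j) z * MvPolynomial.aeval (fun i => z (Fin.castAdd 0 i)) p₁ :=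
  fat_cancel s M L e p a lo hi hbd hdom hint hnz j hej hα hfat

end Summit.KontsevichZagierPeriods.ArrangementNormalForm.JanusBands
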